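import Summits.Parity.GeneralizedHardyLittlewood.Theorems.LeeYangFibresRelativeDimOneFloatingNoSiegelZeros
import Summits.Parity.GeneralizedHardyLittlewood.Theorems.LeeYangFibresRelativeDimOneFloatingSiegelDefs
import Literature.NumberTheory.LFunctions.SiegelZeroExceptionalPrimesProofs
import Literature.Barriers.Parity.SiegelZeroDichotomy
import Mathlib.NumberTheory.Chebyshev
import HarnessLib

/-!
# Route `LeeYangFibres`, crux `RelativeDimOne` (stmt-Parity-14113), line `floating-level-core` (lead seat c5):
# the SIEGEL ENDGAME — `stub_siegelEndgame : SiegelEndgame`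

For every `A ≥ 1` there are `η₂, q₂` such that no Siegel zero `(χ mod q, η)` (`IsSiegelZero`: `χ` primitive
quadratic, `η ≥ 10`, `L(1 − 1/(η log q), χ) = 0`) with `η ≥ η₂`, `q ≥ q₂` admits the character prime number theorem
`‖ψ(u, χ)‖ ≤ u/40` throughout `q^A ≤ u ≤ q^{2A}`.

This is the argument of the landed `not_unboundedSiegelZeros_of_uniformCharPNT`
(`…FloatingNoSiegelZeros.lean`), run over the range `(M, N] = (q^A, q^{2A}]` instead of `(q⌊√q⌋, q²]`, with the
hypothesis `‖ψ(u, χ)‖ ≤ u/40` on `[q^A, q^{2A}]` replacing `UniformCharPNT`. With `L = log q ≥ 22`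
(`q ≥ 320⁴ + 1`):
* Mertens I (`NoSiegel.sum_log_div_prime_Ioc_ge`): `S₁ = Σ_{p ∈ (M, N]} log p/p ≥ log N − log M − 6 = AL − 6`;
* Abel summation (`NoSiegel.abs_sum_div_le_of_partialSums`) from `|Σ_{p ≤ u} Re χ(p) log p| ≤ u/20`
  (`NoSiegel.abs_thetaChi_le`, Chebyshev `ψ(u) − θ(u) ≤ u/40`): `|S_χ| = |Σ Re χ(p) log p/p| ≤ (3 + 2AL)/20`;
* exceptional primes (Tao–Teräväinen 2022, Proposition 3.5 (3.13), the PROVED tree theorem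
  `TaoTeravainen2021_eq313_holds`, with `NoSiegel.sum_one_add_chi_le`):
  `S₁ + S_χ = Σ (1 + Re χ(p)) log p/p ≤ 2 log N · Σ_{exc, q < p ≤ N} 1/p ≤ 4AL · 2AK/η ≤ AL/10` once `η ≥ 80AK`.
Hence `0.8·AL ≤ 6.15`, contradicting `A ≥ 1`, `L ≥ 22`.

References: Tao–Teräväinen, J. London Math. Soc. 106 (2022), Prop. 3.5; Hardy–Wright Thm 425 (Mertens I).
-/

noncomputable section

open scoped BigOperators Classical ArithmeticFunction.vonMangoldt Chebyshev
open Finset Filter Real Literature.NumberTheory.Sieve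
open Summit.Parity.GeneralizedHardyLittlewood.Cruxes.RelativeDimOne.GallagherBackwards (classPsi charPsi)
open Summit.Parity.GeneralizedHardyLittlewood.Cruxes.RelativeDimOne.GallagherBackwardsSplit
open Summit.Parity.GeneralizedHardyLittlewood.Cruxes.RelativeDimOne.TypeSplit

namespace Summit.Parity.GeneralizedHardyLittlewood.Cruxes.RelativeDimOne.FloatingLevelCore

open Literature.Barriers.Parity (IsSiegelZero)
open Literature.NumberTheory.LFunctions.SiegelZero (excPrimes mem_excPrimes TaoTeravainen2021_eq313_holds)
open NoSiegel

/-- **Siegel endgame** (stub E of the line `floating-level-core`): for every `A ≥ 1` there are `η₂, q₂` such that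
no Siegel zero `(χ mod q, η)` with `η ≥ η₂`, `q ≥ q₂` admits `‖ψ(u, χ)‖ ≤ u/40` throughout `q^A ≤ u ≤ q^{2A}`
(Tao–Teräväinen 2022, Proposition 3.5 (3.13) + Mertens I + Chebyshev + Abel summation; see the module
docstring). -/
theorem stub_siegelEndgame : SiegelEndgame := by
  intro A hA1
  obtain ⟨K, η₀, hK⟩ := TaoTeravainen2021_eq313_holds 1 one_pos
  refine ⟨max η₀ (80 * A * K), 320 ^ 4 + 1, ?_⟩
  intro q _ χ η hZ hη hq320 hPNT
  have hprim := hZ.1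
  have hquad := hZ.2.1
  have h10 := hZ.2.2.1
  have hL := hZ.2.2.2
  have hη₀ : η₀ ≤ η := le_trans (le_max_left _ _) hη
  have hηK : 80 * A * K ≤ η := le_trans (le_max_right _ _) hη
  have hη0 : 0 < η := by linarith
  have hq2 : 2 ≤ q := le_trans (by norm_num) hq320
  have hqR : (320 : ℝ) ^ 4 ≤ q := by exact_mod_cast (show 320 ^ 4 ≤ q by omega)
  have hq0 : (0 : ℝ) < q := by positivity
  have hL22 : 22 ≤ Real.log q := log_ge_of_large hqR
  have hA_R : (1 : ℝ) ≤ A := by exact_mod_cast hA1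
  set M := q ^ A with hMdef
  set N := q ^ (2 * A) with hNdef
  have hqM : q ≤ M := Nat.le_self_pow (by omega) q
  have hM1 : 1 ≤ M := le_trans (by omega) hqM
  have hMN : M < N := Nat.pow_lt_pow_right (by omega) (by omega)
  have hN_R : ((N : ℕ) : ℝ) = (q : ℝ) ^ (2 * A) := by rw [hNdef, Nat.cast_pow]
  have hM_R : ((M : ℕ) : ℝ) = (q : ℝ) ^ A := by rw [hMdef, Nat.cast_pow]
  have hlogN : Real.log N = 2 * (A : ℝ) * Real.log q := by
    rw [hN_R, Real.log_pow]; push_cast; ring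
  have hlogM : Real.log M = (A : ℝ) * Real.log q := by rw [hM_R, Real.log_pow]
  -- pointwise bound `|θ_χ(u+1)| ≤ u/20` on `[M, N]`
  set g : ℕ → ℝ := fun i => if i.Prime then (χ (i : ZMod q)).re * Real.log i else 0 with hg
  have hB : ∀ u : ℕ, M ≤ u → u ≤ N → |∑ i ∈ range (u + 1), g i| ≤ 2 * (1 / 40) * u := by
    intro u hMu huN
    have huq : q ≤ u := hqM.trans hMu
    have hψ : ‖charPsi χ u‖ ≤ 1 / 40 * u := by
      have := hPNT u hMu huN
      linarith
    have hC : ψ (u : ℝ) - θ (u : ℝ) ≤ 1 / 40 * u := by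
      have := psi_sub_theta_le_div (hqR.trans (show (q : ℝ) ≤ (u : ℝ) by exact_mod_cast huq))
      linarith
    exact abs_thetaChi_le hψ hC
  -- (1) Abel: `|S_χ| ≤ (3 + 2AL)/20`
  have hSχ := abs_sum_div_le_of_partialSums g hM1 hMN (by norm_num : (0 : ℝ) ≤ 1 / 40) hB
  rw [hlogN] at hSχ
  -- (2) Mertens: `S₁ ≥ AL − 6`
  have hS₁ := sum_log_div_prime_Ioc_ge hM1 hMN.le
  rw [hlogN, hlogM] at hS₁
  -- (3) exceptional primes: `S₁ + S_χ ≤ 2 log N · (2AK/η)`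
  have hT : ⌊(q : ℝ) ^ ((1 + 1) / 2 : ℝ)⌋₊ = q := by norm_num
  have hexc := hK q χ hprim hquad η hη₀ hL (N : ℝ) (by
    rw [show ((1 + 1) / 2 : ℝ) = 1 by norm_num, Real.rpow_one]; exact_mod_cast hMN.le.trans' hqM)
  rw [hT, Nat.floor_natCast, hlogN] at hexc
  have hLne : Real.log q ≠ 0 := by linarith
  have h2L : 2 * (A : ℝ) * Real.log q / Real.log q = 2 * A := by
    rw [mul_div_assoc, div_self hLne, mul_one]
  rw [h2L] at hexc
  have hSplus := sum_one_add_chi_le χ (N := N) hqM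
  rw [hlogN] at hSplus
  have hident : ∑ i ∈ Ioc M N, (if i.Prime then Real.log i / i else 0) + ∑ i ∈ Ioc M N, g i / i =
      ∑ i ∈ Ioc M N, (if i.Prime then (1 + (χ (i : ZMod q)).re) * Real.log i / i else 0) := by
    rw [← Finset.sum_add_distrib]
    refine Finset.sum_congr rfl fun i _ => ?_
    by_cases hp : i.Prime
    · simp only [hg, hp, if_true]; ring
    · simp [hg, hp]
  have hAL0 : 0 ≤ (A : ℝ) * Real.log q := by positivity
  have hexcL : 2 * (2 * (A : ℝ) * Real.log q) * ∑ p ∈ excPrimes χ (Ioc q N), (1 : ℝ) / p ≤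
      (A : ℝ) * Real.log q / 10 := by
    rcases le_or_gt K 0 with hK0 | hK0
    · have hsum0 : ∑ p ∈ excPrimes χ (Ioc q N), (1 : ℝ) / p ≤ 0 :=
        hexc.trans (div_nonpos_of_nonpos_of_nonneg (by nlinarith) hη0.le)
      nlinarith
    · have h80 : K * (2 * (A : ℝ)) / η ≤ 1 / 40 := by
        rw [div_le_iff₀ hη0]; nlinarith
      calc 2 * (2 * (A : ℝ) * Real.log q) * ∑ p ∈ excPrimes χ (Ioc q N), (1 : ℝ) / p
          ≤ 2 * (2 * (A : ℝ) * Real.log q) * (1 / 40) :=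
            mul_le_mul_of_nonneg_left (hexc.trans h80) (by positivity)
        _ = (A : ℝ) * Real.log q / 10 := by ring
  have hAL : (22 : ℝ) ≤ (A : ℝ) * Real.log q := by nlinarith
  have habs := abs_le.mp hSχ
  linarith [habs.1, hident]

end Summit.Parity.GeneralizedHardyLittlewood.Cruxes.RelativeDimOne.FloatingLevelCore

end
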